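import Mathlib
import Summits.CriticalPhenomena.CardyFormulaZ2.Theses.CardyMagicRigidity
import Literature.Probability.RandomPlanarGeometry.NestingTransform
import Literature.Probability.Percolation.FullPlaneCNL
import HarnessLib

/-!
# `TransferContinuity` (stmt-CriticalPhenomena-4838): the logic of the item and its 3ε-reduction

Route `CardyMagicRigidity` (sub-problem `CriticalPhenomena/CardyFormulaZ2`), support item
`TransferContinuity ≡ X → ∀ admissible f, Λ^{ℤ²}_δ(f) − Λ^{𝕋}_δ(f) → 0` (`X = LoopLimitZ2EqT`,
`Λ_δ(f) = E[∏_u 2cos(∫_{W(u,·)≠0} f + π/3)]`, the `cos_μ`-twisted nesting transform at mesh `δ`).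
This helper file (sorry-free, no new definition) records

* §1 the rôle of the item in the route, as theorems between route decls:
  `magicFormulaT_of_loopLimitZ2EqT : LoopLimitZ2EqT → MagicFormulaZ2 → TransferContinuity →
  MagicFormulaT` ("with the ℤ² magic formula, transfer continuity makes the 𝕋 magic formula
  NECESSARY for loop universality"), its contrapositive `not_loopLimitZ2EqT_of_not_magicFormulaT`
  (kill criterion (i) of the route: a refutation of `MagicFormulaT` refutes `X`), and the trivial
  converse `transferContinuity_of_magicFormulas : MagicFormulaZ2 → MagicFormulaT →
  TransferContinuity`;
* §2 the literal integrals of the item in the tree's vocabulary (`integral_bond_eq`,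
  `loops_siteLoopConfig`, `integral_site_eq`: the two expectations are
  `truncNestingTransform P X f 0` of `Literature.Probability.RandomPlanarGeometry.NestingTransform`
  for `(P, X) = (bondPercolation (zdGraph 2) half, bondLoopConfig δ 0)` and
  `(triSitePercolation half, siteLoopConfig δ)`);
* §3 an abstract 3ε-lemma `tendsto_sub_of_truncation` (pure filters) and
* §4 **the reduction** `transferContinuity_of_truncation`: `TransferContinuity` follows from
  (Z) small-loop negligibility on `ℤ²` — for every admissible `f` and `κ > 0`, for all small
  cut-offs `η` and then all small meshes `δ`, `|Λ^{ℤ²}_δ(f) − Λ^{ℤ²,≥η}_δ(f)| ≤ κ`, where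
  `Λ^{≥η}` is the transform truncated to loops of trace-diameter `≥ η`
  (`truncNestingTransform … f η`); (T) the same on `𝕋`; (B) the transfer of the TRUNCATED
  transform along `X`: `X → ∀ f κ, ∃ᶠ η → 0⁺, ∀ᶠ δ → 0⁺, |Λ^{ℤ²,≥η}_δ(f) − Λ^{𝕋,≥η}_δ(f)| ≤ κ`
  (only frequently-in-`η` is asked, so that cut-offs at which loop diameters accumulate may be
  avoided). (B) is the "restrict to big loops and couple" device of Duminil-Copin–Kozlowski–
  Lammers–Manolescu, arXiv:2603.06268 §5 p. 37 (RSW / one-arm bounds on both lattices, winding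
  interiors of `udist`-close loops); (Z)/(T) is the lattice-uniform centring of the small nested
  loops (where `∫ f = 0` enters), deferred in print to the authors' unreleased companion. None of
  (Z), (T), (B) is asserted here.

## References

* H. Duminil-Copin, K. K. Kozlowski, P. Lammers, I. Manolescu, arXiv:2603.06268 (2026), §3.2,
  Cor. 10, §5 pp. 37–38.
* H. Duminil-Copin, K. K. Kozlowski, D. Krachun, I. Manolescu, M. Oulamara, arXiv:2012.11672v2,
  §1.2 eq. (1)–(2) (`d_CN`).
-/

noncomputable section

open MeasureTheory Set Filter Metric
open scoped Topology Real

namespace Summit.CriticalPhenomena.CardyFormulaZ2.Theorems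

open Literature.Probability.RandomPlanarGeometry Literature.Probability.Percolation
  Literature.Probability.LatticeModels
open Summit.CriticalPhenomena.CardyFormulaZ2.Theses.CardyMagicRigidity

/-! ### §1 The item inside the route: pure limit algebra -/

/-- **`MagicFormulaT` is necessary for loop universality, given the `ℤ²` magic formula and
transfer continuity**: `X → MagicFormulaZ2 → TransferContinuity → MagicFormulaT`
(`Λ^𝕋_δ = Λ^{ℤ²}_δ − (Λ^{ℤ²}_δ − Λ^𝕋_δ) → G(f) − 0`). [folklore] -/
theorem magicFormulaT_of_loopLimitZ2EqT (hX : LoopLimitZ2EqT) (h2 : MagicFormulaZ2)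
    (h9 : TransferContinuity) : MagicFormulaT := by
  intro f R C hf hC hR h0
  have key := (h2 f R C hf hC hR h0).sub (h9 hX f R C hf hC hR h0)
  simp only [sub_sub_cancel, sub_zero] at key
  exact key

/-- **Kill criterion (i) of the route, formally**: given the `ℤ²` magic formula and transfer
continuity, a refutation of `MagicFormulaT` refutes loop universality `X = LoopLimitZ2EqT`.
[folklore] -/
theorem not_loopLimitZ2EqT_of_not_magicFormulaT (h2 : MagicFormulaZ2) (h9 : TransferContinuity)
    (h4 : ¬ MagicFormulaT) : ¬ LoopLimitZ2EqT :=
  fun hX ↦ h4 (magicFormulaT_of_loopLimitZ2EqT hX h2 h9)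

/-- The trivial converse: both magic formulas give transfer continuity outright (the two
transforms have the same limit), without `X`. [folklore] -/
theorem transferContinuity_of_magicFormulas (h2 : MagicFormulaZ2) (h4 : MagicFormulaT) :
    TransferContinuity := by
  intro _ f R C hf hC hR h0
  have key := (h2 f R C hf hC hR h0).sub (h4 f R C hf hC hR h0)
  rw [sub_self] at key
  exact key

/-! ### §2 The item's integrals in the vocabulary of `NestingTransform` -/

/-- The bond-`ℤ²` expectation of the item is the (un)truncated nesting transform of
`(bondPercolation (zdGraph 2) half, bondLoopConfig δ 0)` at cut-off `0`. [folklore] -/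
theorem integral_bond_eq (f : ℂ → ℝ) (δ : ℝ) :
    (∫ cfg, (∏ᶠ u ∈ ((bondLoopConfig δ 0 cfg).F 0 ∪ (bondLoopConfig δ 0 cfg).F 1),
        2 * Real.cos ((∫ z in {z : ℂ | u.wind z ≠ 0}, f z) + Real.pi / 3))
          ∂(bondPercolation (zdGraph 2) half)) =
      truncNestingTransform (bondPercolation (zdGraph 2) half) (bondLoopConfig δ 0) f 0 := by
  rw [truncNestingTransform_zero]
  rfl

/-- Both types together of the site-`𝕋` configuration are the untyped honeycomb interface loops
over which `MagicFormulaT` / `TransferContinuity` take their product. [folklore] -/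
theorem loops_siteLoopConfig (δ : ℝ) (cfg : SiteConfig (Site 2)) :
    (siteLoopConfig δ cfg).loops =
      {u : UnbasedLoop ℂ | ∃ (v : HexVertex) (γ : hexGraph.Walk v v), IsSiteInterfaceLoop cfg γ ∧
        u = UnbasedLoop.mk (BasedLoop.mk (siteLoopCurve δ γ) (isLoop_siteLoopCurve δ γ))} := by
  ext u
  constructor
  · rintro (⟨v, γ, h, -, rfl⟩ | ⟨v, γ, h, -, rfl⟩) <;> exact ⟨v, γ, h, rfl⟩
  · rintro ⟨v, γ, h, rfl⟩
    by_cases hs : 0 < shoelace (γ.support.map hexCenter)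
    · exact Or.inr ⟨v, γ, h, ⟨fun _ ↦ hs, fun _ ↦ rfl⟩, rfl⟩
    · exact Or.inl ⟨v, γ, h, ⟨fun h0 ↦ absurd h0 (by decide), fun h' ↦ absurd h' hs⟩, rfl⟩

/-- The site-`𝕋` expectation of the item is the nesting transform of
`(triSitePercolation half, siteLoopConfig δ)` at cut-off `0`. [folklore] -/
theorem integral_site_eq (f : ℂ → ℝ) (δ : ℝ) :
    (∫ cfg, (∏ᶠ u ∈ {u : UnbasedLoop ℂ | ∃ (v : HexVertex) (γ : hexGraph.Walk v v),
        IsSiteInterfaceLoop cfg γ ∧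
          u = UnbasedLoop.mk (BasedLoop.mk (siteLoopCurve δ γ) (isLoop_siteLoopCurve δ γ))},
        2 * Real.cos ((∫ z in {z : ℂ | u.wind z ≠ 0}, f z) + Real.pi / 3))
          ∂(triSitePercolation half)) =
      truncNestingTransform (triSitePercolation half) (siteLoopConfig δ) f 0 := by
  rw [truncNestingTransform_zero]
  congr 1
  funext cfg
  rw [LoopConfig.nestingWeight, loops_siteLoopConfig]
  rfl

/-! ### §3 An abstract 3ε-lemma -/

/-- `|x + y - z| ≤ |x| + |y| + |z|` (helper; Mathlib has `abs_add_three` for sums). [folklore] -/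
theorem abs_add_sub_le_three (x y z : ℝ) : |x + y - z| ≤ |x| + |y| + |z| := by
  calc |x + y - z| ≤ |x + y| + |z| := abs_sub _ _
    _ ≤ |x| + |y| + |z| := by gcongr; exact abs_add_le _ _

/-- **3ε-lemma for truncations.** If `a` and `b` are approximated by their truncations `A η`,
`B η` within any `κ > 0` for all cut-offs `η` in an eventually-set of a filter `k` (then
eventually along `l`), and the truncations agree within `κ` for `η` in a frequently-set of `k`
(then eventually along `l`), then `a − b → 0` along `l`. [folklore] -/
theorem tendsto_sub_of_truncation {ι : Type*} {l : Filter ι} {k : Filter ℝ}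
    {a b : ι → ℝ} {A B : ℝ → ι → ℝ}
    (hA : ∀ κ : ℝ, 0 < κ → ∀ᶠ η in k, ∀ᶠ i in l, |a i - A η i| ≤ κ)
    (hB : ∀ κ : ℝ, 0 < κ → ∀ᶠ η in k, ∀ᶠ i in l, |b i - B η i| ≤ κ)
    (hAB : ∀ κ : ℝ, 0 < κ → ∃ᶠ η in k, ∀ᶠ i in l, |A η i - B η i| ≤ κ) :
    Tendsto (fun i ↦ a i - b i) l (𝓝 0) := by
  rw [Metric.tendsto_nhds]
  intro ε hε
  have hκ : 0 < ε / 4 := by positivity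
  obtain ⟨η, hη, hηA, hηB⟩ :=
    ((hAB _ hκ).and_eventually ((hA _ hκ).and (hB _ hκ))).exists
  filter_upwards [hη, hηA, hηB] with i hi hiA hiB
  rw [Real.dist_eq, sub_zero]
  calc |a i - b i| = |(a i - A η i) + (A η i - B η i) - (b i - B η i)| := by ring_nf
    _ ≤ |a i - A η i| + |A η i - B η i| + |b i - B η i| := abs_add_sub_le_three _ _ _
    _ ≤ ε / 4 + ε / 4 + ε / 4 := by gcongr
    _ < ε := by linarith

/-! ### §4 The reduction of `TransferContinuity` to truncation + truncated transfer -/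

/-- **Reduction of `TransferContinuity`.** Write `Λ^{B,≥η}_δ(f) = truncNestingTransform
(bondPercolation (zdGraph 2) half) (bondLoopConfig δ 0) f η` and `Λ^{S,≥η}_δ(f)` likewise for
`(triSitePercolation half, siteLoopConfig δ)` (`η = 0`: the item's expectations,
`integral_bond_eq`, `integral_site_eq`). Suppose
(Z) for every admissible `f` (measurable, `|f| ≤ C`, `f = 0` off `‖z‖ ≤ R`, `∫ f = 0`) and
    `κ > 0`: `∀ᶠ η → 0⁺, ∀ᶠ δ → 0⁺, |Λ^{B,≥0}_δ(f) − Λ^{B,≥η}_δ(f)| ≤ κ` (small loops of bond-`ℤ²`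
    are negligible, uniformly in the mesh);
(T) the same for site-`𝕋`;
(B) `X → ∀ admissible f, ∀ κ > 0, ∃ᶠ η → 0⁺, ∀ᶠ δ → 0⁺, |Λ^{B,≥η}_δ(f) − Λ^{S,≥η}_δ(f)| ≤ κ`
    (transfer of the truncated transform along the `d_CN`-merging `X`).
Then `TransferContinuity`. [folklore] -/
theorem transferContinuity_of_truncation
    (hZ : ∀ (f : ℂ → ℝ) (R C : ℝ), Measurable f → (∀ z, |f z| ≤ C) → (∀ z, R < ‖z‖ → f z = 0) →
      ∫ z, f z = 0 → ∀ κ : ℝ, 0 < κ → ∀ᶠ η in 𝓝[>] (0 : ℝ), ∀ᶠ δ in 𝓝[>] (0 : ℝ),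
        |truncNestingTransform (bondPercolation (zdGraph 2) half) (bondLoopConfig δ 0) f 0 -
          truncNestingTransform (bondPercolation (zdGraph 2) half) (bondLoopConfig δ 0) f η| ≤ κ)
    (hT : ∀ (f : ℂ → ℝ) (R C : ℝ), Measurable f → (∀ z, |f z| ≤ C) → (∀ z, R < ‖z‖ → f z = 0) →
      ∫ z, f z = 0 → ∀ κ : ℝ, 0 < κ → ∀ᶠ η in 𝓝[>] (0 : ℝ), ∀ᶠ δ in 𝓝[>] (0 : ℝ),
        |truncNestingTransform (triSitePercolation half) (siteLoopConfig δ) f 0 -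
          truncNestingTransform (triSitePercolation half) (siteLoopConfig δ) f η| ≤ κ)
    (hB : LoopLimitZ2EqT → ∀ (f : ℂ → ℝ) (R C : ℝ), Measurable f → (∀ z, |f z| ≤ C) →
      (∀ z, R < ‖z‖ → f z = 0) → ∫ z, f z = 0 → ∀ κ : ℝ, 0 < κ →
        ∃ᶠ η in 𝓝[>] (0 : ℝ), ∀ᶠ δ in 𝓝[>] (0 : ℝ),
          |truncNestingTransform (bondPercolation (zdGraph 2) half) (bondLoopConfig δ 0) f η -
            truncNestingTransform (triSitePercolation half) (siteLoopConfig δ) f η| ≤ κ) :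
    TransferContinuity := by
  intro hX f R C hf hC hR h0
  have key := tendsto_sub_of_truncation (l := 𝓝[>] (0 : ℝ)) (k := 𝓝[>] (0 : ℝ))
    (hZ f R C hf hC hR h0) (hT f R C hf hC hR h0) (hB hX f R C hf hC hR h0)
  refine key.congr' (Eventually.of_forall fun δ ↦ ?_)
  simp only [integral_bond_eq, integral_site_eq]

end Summit.CriticalPhenomena.CardyFormulaZ2.Theorems

end
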